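import Mathlib
import Literature.Analysis.ODE.NearInverseSquareTrueChainHalf
import Literature.Analysis.PDE.TruePolynomialKernel
import Literature.Analysis.PDE.TowerChannelEnergy

/-!
# True far kernel elements at unit scale for a near-inverse-square potential

Analysis/PDE support file (everything proved). Let `W ≥ 0` be continuous with
`|W(x) − n(n+1)/x²| ≤ ε x^{-5/2}` on `[½,∞)`, `ε ≤ 1/(64(n+1))`, and let `2k + π ≤ n`, `π ∈ {0,1}`.
From the true chain of `NearInverseSquareTrueChainHalf` (data `z^{2k−n}`, parity `π`) and the
cut-off construction `TruePolynomialKernel.exists_truePolynomial` we obtain a global `C²` function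
`B(t,x) = Σ_i t^{2i+π} a_i(x)` (`x ≥ 7/8`) solving `B_tt − B_xx + W B = 0` on `{x ≥ 1}`, with
Cauchy data `((1−π) a_0, π a_0)` on `[1,∞)`, where `|a_0 − x^{2k−n}| ≤ Kε x^{2k−n−1/2}` and
`|a_0' − (2k−n)x^{2k−n−1}| ≤ Kε x^{2k−n−3/2}` (`x ≥ ½`); its energy density on the far cone
`{x > 1+|t|}` is `O(x⁻²)` (`TowerChannelEnergy.tpoly_energy_pointwise`), so its far `W`-energy is
finite and tends to `0` as `t → ±∞` (`exists_farKernelElement`). These are the per-power position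
(`π = 0`) and velocity (`π = 1`) kernel elements of the far channel estimate `FixedModeChannels`
(route PhotonSphereChannels, stmt-FinalStateConjecture-10048). Folklore
(Kenig–Lawrie–Liu–Schlag 2015 for the exact potential).
-/

noncomputable section

namespace Literature.Analysis.PDE

open Set Filter MeasureTheory Finset Literature.Analysis.ODE
open scoped Topology

/-- Re-indexing a parity sum `Σ_{i≤j} f_i g_{2i+π}` as a sum over all exponents `m ≤ 2j+π`.
[folklore] -/
theorem sum_parity_reindex (f g : ℕ → ℝ) (j π : ℕ) :
    ∑ i ∈ range (j + 1), f i * g (2 * i + π)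
      = ∑ m ∈ range (2 * j + π + 1),
          (∑ i ∈ range (j + 1), if m = 2 * i + π then f i else 0) * g m := by
  symm
  calc ∑ m ∈ range (2 * j + π + 1), (∑ i ∈ range (j + 1), if m = 2 * i + π then f i else 0) * g m
      = ∑ m ∈ range (2 * j + π + 1), ∑ i ∈ range (j + 1),
          (if m = 2 * i + π then f i * g m else 0) := by
        refine Finset.sum_congr rfl fun m _ => ?_
        rw [Finset.sum_mul]
        refine Finset.sum_congr rfl fun i _ => ?_
        split_ifs <;> simp
    _ = ∑ i ∈ range (j + 1), ∑ m ∈ range (2 * j + π + 1),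
          (if m = 2 * i + π then f i * g m else 0) := Finset.sum_comm
    _ = ∑ i ∈ range (j + 1), f i * g (2 * i + π) := by
        refine Finset.sum_congr rfl fun i hi => ?_
        rw [Finset.sum_ite_eq', if_pos (by simp only [Finset.mem_range] at hi ⊢; omega)]

/-- The Cauchy data of `Σ_i t^{2i+π} a_i` at `t = 0`: `((1−π) a_0, π a_0)` (`π ∈ {0,1}`).
[folklore] -/
theorem parity_data_sums (u : ℕ → ℝ) (k π : ℕ) (hπ : π ≤ 1) :
    (∑ i ∈ range (k + 1), (0 : ℝ) ^ (2 * i + π) * u i) = (1 - (π : ℝ)) * u 0 ∧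
    (∑ i ∈ range (k + 1), ((2 * i + π : ℕ) : ℝ) * (0 : ℝ) ^ (2 * i + π - 1) * u i) = (π : ℝ) * u 0 := by
  rcases Nat.le_one_iff_eq_zero_or_eq_one.1 hπ with rfl | rfl
  · constructor
    · rw [Finset.sum_range_succ']; simp
    · rw [Finset.sum_range_succ',
        Finset.sum_eq_zero (fun x _ => by rw [zero_pow (by omega), mul_zero, zero_mul])]
      simp
  · constructor
    · simp
    · rw [Finset.sum_range_succ',
        Finset.sum_eq_zero (fun x _ => by rw [zero_pow (by omega), mul_zero, zero_mul])]
      simp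

/-- **True far kernel elements.** See the module docstring. [folklore] -/
theorem exists_farKernelElement (n k π : ℕ) (hπ : π ≤ 1) (hk : 2 * k + π ≤ n) :
    ∃ K : ℝ, 0 ≤ K ∧ ∀ {W : ℝ → ℝ} {ε : ℝ}, Continuous W → (∀ x, 0 ≤ W x) → 0 ≤ ε →
      ε ≤ 1 / (64 * ((n : ℝ) + 1)) →
      (∀ x : ℝ, 1 / 2 ≤ x → |W x - (n : ℝ) * ((n : ℝ) + 1) / x ^ 2| ≤ ε * x ^ (-(5 : ℝ) / 2)) →
      ∃ (B : ℝ → ℝ → ℝ) (f f' : ℝ → ℝ), ContDiff ℝ 2 (Function.uncurry B) ∧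
        (∀ t x, 1 ≤ x →
          iteratedDeriv 2 (fun τ => B τ x) t - iteratedDeriv 2 (B t) x + W x * B t x = 0) ∧
        IntegrableOn (fun x => deriv (fun τ => B τ x) 0 ^ 2 + deriv (B 0) x ^ 2
          + W x * B 0 x ^ 2) (Ioi 1) ∧
        Tendsto (fun t => ∫ x in Ioi (1 + |t|), (deriv (fun τ => B τ x) t ^ 2
          + deriv (B t) x ^ 2 + W x * B t x ^ 2)) atTop (𝓝 0) ∧
        Tendsto (fun t => ∫ x in Ioi (1 + |t|), (deriv (fun τ => B τ x) t ^ 2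
          + deriv (B t) x ^ 2 + W x * B t x ^ 2)) atBot (𝓝 0) ∧
        (∃ (N : ℕ) (α : ℕ → ℝ → ℝ), ∀ z : ℝ × ℝ, 1 + |z.1| < z.2 →
          B z.1 z.2 = ∑ i ∈ Finset.range N, α i z.2 * z.1 ^ i) ∧
        (∀ x, 1 ≤ x → B 0 x = (1 - (π : ℝ)) * f x ∧ deriv (fun τ => B τ x) 0 = (π : ℝ) * f x ∧
          deriv (B 0) x = (1 - (π : ℝ)) * f' x) ∧
        (∀ x, (1 / 2 : ℝ) < x → HasDerivAt f (f' x) x) ∧ Continuous f ∧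
        (∀ x : ℝ, 1 / 2 ≤ x → |f x - x ^ ((2 * k : ℝ) - n)| ≤ K * ε * x ^ ((2 * k : ℝ) - n - 1 / 2) ∧
          |f' x - ((2 * k : ℝ) - n) * x ^ ((2 * k : ℝ) - n - 1)|
            ≤ K * ε * x ^ ((2 * k : ℝ) - n - 3 / 2)) := by
  obtain ⟨K, hK0, hK⟩ := exists_trueChain_half n k π (by omega : 2 * k ≤ n)
  refine ⟨K, hK0, ?_⟩
  intro W ε hW hW0 hε0 hε hclose
  have hn0 : (0 : ℝ) ≤ n := n.cast_nonneg
  have hε1 : ε ≤ 1 := hε.trans (by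
    rw [div_le_one (by positivity)]; nlinarith)
  obtain ⟨P, a, a', c, hPc, hPW, hc0, htop, hcont, hder, hcl, hcK⟩ := hK hW hε0 hε hclose
  have hπ' : π * (π - 1) = 0 := by
    rcases Nat.le_one_iff_eq_zero_or_eq_one.1 hπ with rfl | rfl <;> rfl
  obtain ⟨p, hpC, hpform, hpres, hpder⟩ :=
    exists_truePolynomial (a := a) (a' := a') (j := k) hPc π hπ' htop hcont hder
  -- the plain `t`-coefficients
  set α : ℕ → ℝ → ℝ := fun m z => ∑ i ∈ range (k + 1), if m = 2 * i + π then a i z else 0 with hα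
  set N : ℕ := 2 * k + π + 1 with hN
  have hαder : ∀ m z, (1 / 2 : ℝ) < z →
      HasDerivAt (α m) (∑ i ∈ range (k + 1), if m = 2 * i + π then a' i z else 0) z := by
    intro m z hz
    simp only [hα]
    refine HasDerivAt.fun_sum fun i hi => ?_
    by_cases h : m = 2 * i + π
    · simp only [h, if_true]
      exact (hder i (by simp only [Finset.mem_range] at hi; omega) z hz).1
    · have e : (fun x => if m = 2 * i + π then a i x else 0) = fun _ => (0 : ℝ) := by
        funext x; rw [if_neg h]
      rw [e, if_neg h]; exact hasDerivAt_const z 0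
  have hp : ∀ t z, 1 ≤ z → p t z = ∑ m ∈ range N, α m z * t ^ m := by
    intro t z hz
    rw [hpform t z (by linarith)]
    have := sum_parity_reindex (fun i => a i z) (fun m => t ^ m) k π
    rw [← this]
    exact Finset.sum_congr rfl fun i _ => mul_comm _ _
  have hpt : ∀ t z, 1 ≤ z →
      deriv (fun τ => p τ z) t = ∑ m ∈ range N, α m z * ((m : ℝ) * t ^ (m - 1)) := by
    intro t z hz
    rw [(hpder t z hz).1]
    have := sum_parity_reindex (fun i => a i z) (fun m => (m : ℝ) * t ^ (m - 1)) k π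
    rw [← this]
    exact Finset.sum_congr rfl fun i _ => by push_cast; ring
  have hpz : ∀ t z, 1 ≤ z → deriv (p t) z = ∑ m ∈ range N, deriv (α m) z * t ^ m := by
    intro t z hz
    rw [(hpder t z hz).2]
    have := sum_parity_reindex (fun i => a' i z) (fun m => t ^ m) k π
    have e : ∀ m, deriv (α m) z = ∑ i ∈ range (k + 1), if m = 2 * i + π then a' i z else 0 :=
      fun m => (hαder m z (by linarith)).deriv
    simp only [e]
    rw [← this]
    exact Finset.sum_congr rfl fun i _ => mul_comm _ _
  -- size of the coefficients on `[1,∞)`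
  have hγle : ∀ i : ℕ, (2 * k : ℝ) - n - 2 * i ≤ 0 := fun i => by
    have : (2 * k : ℝ) ≤ n := by exact_mod_cast (by omega : 2 * k ≤ n)
    have : (0 : ℝ) ≤ i := i.cast_nonneg
    linarith
  have hγabs : ∀ i : ℕ, i ≤ k → |(2 * k : ℝ) - n - 2 * i| ≤ n := fun i hi => by
    have h1 : (2 * i : ℝ) ≤ 2 * k := by exact_mod_cast (by omega : 2 * i ≤ 2 * k)
    rw [abs_le]; constructor <;> linarith [hγle i]
  have hai : ∀ i, i ≤ k → ∀ z : ℝ, 1 ≤ z →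
      |a i z| ≤ 2 * K * z ^ ((2 * k : ℝ) - n - 2 * i) ∧
      |a' i z| ≤ K * ((n : ℝ) + 1) * z ^ ((2 * k : ℝ) - n - 2 * i - 1) := by
    intro i hi z hz
    have hz0 : 0 < z := by linarith
    obtain ⟨h1, h2⟩ := hcl i hi z (by linarith)
    have hc := hcK i hi
    set γ : ℝ := (2 * k : ℝ) - n - 2 * i with hγ
    have hzle : ∀ r s : ℝ, s ≤ r → z ^ s ≤ z ^ r := fun r s h =>
      Real.rpow_le_rpow_of_exponent_le hz h
    have hzγ : 0 ≤ z ^ γ := Real.rpow_nonneg hz0.le _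
    have hzγ1 : 0 ≤ z ^ (γ - 1) := Real.rpow_nonneg hz0.le _
    constructor
    · have h3 : |a i z| ≤ |c i| * z ^ γ + K * ε * z ^ (γ - 1 / 2) := by
        have := abs_sub_abs_le_abs_sub (a i z) (c i * z ^ γ)
        rw [abs_mul, abs_of_nonneg hzγ] at this
        linarith
      have h4 : K * ε * z ^ (γ - 1 / 2) ≤ K * z ^ γ := by
        calc K * ε * z ^ (γ - 1 / 2) ≤ K * 1 * z ^ γ :=
              mul_le_mul (mul_le_mul_of_nonneg_left hε1 hK0) (hzle _ _ (by linarith))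
                (Real.rpow_nonneg hz0.le _) (by positivity)
          _ = K * z ^ γ := by ring
      have h5 : |c i| * z ^ γ ≤ K * z ^ γ := mul_le_mul_of_nonneg_right hc hzγ
      linarith
    · have h3 : |a' i z| ≤ |c i| * |γ| * z ^ (γ - 1) + K * ε * z ^ (γ - 3 / 2) := by
        have := abs_sub_abs_le_abs_sub (a' i z) (c i * γ * z ^ (γ - 1))
        rw [abs_mul, abs_mul, abs_of_nonneg hzγ1] at this
        linarith
      have h4 : K * ε * z ^ (γ - 3 / 2) ≤ K * z ^ (γ - 1) := by
        calc K * ε * z ^ (γ - 3 / 2) ≤ K * 1 * z ^ (γ - 1) :=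
              mul_le_mul (mul_le_mul_of_nonneg_left hε1 hK0) (hzle _ _ (by linarith))
                (Real.rpow_nonneg hz0.le _) (by positivity)
          _ = K * z ^ (γ - 1) := by ring
      have h5 : |c i| * |γ| * z ^ (γ - 1) ≤ K * n * z ^ (γ - 1) :=
        mul_le_mul_of_nonneg_right (mul_le_mul hc (hγabs i hi) (abs_nonneg _) hK0) hzγ1
      calc |a' i z| ≤ K * n * z ^ (γ - 1) + K * z ^ (γ - 1) := by linarith
        _ = K * ((n : ℝ) + 1) * z ^ (γ - 1) := by ring
  set L : ℝ := ((k : ℝ) + 1) * (2 * K * ((n : ℝ) + 1)) with hL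
  have hL0 : 0 ≤ L := by positivity
  have hαb : ∀ m, m < N → ∀ z : ℝ, 1 ≤ z → |α m z| ≤ L * z ^ (-(m : ℝ)) := by
    intro m hm z hz
    have hz0 : 0 < z := by linarith
    simp only [hα]
    refine (Finset.abs_sum_le_sum_abs _ _).trans ?_
    have hterm : ∀ i ∈ range (k + 1), |(if m = 2 * i + π then a i z else 0)|
        ≤ 2 * K * ((n : ℝ) + 1) * z ^ (-(m : ℝ)) := by
      intro i hi
      have hi' : i ≤ k := by simp only [Finset.mem_range] at hi; omega
      split_ifs with h
      · calc |a i z| ≤ 2 * K * z ^ ((2 * k : ℝ) - n - 2 * i) := (hai i hi' z hz).1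
          _ ≤ 2 * K * z ^ (-(m : ℝ)) := by
              refine mul_le_mul_of_nonneg_left (Real.rpow_le_rpow_of_exponent_le hz ?_) (by positivity)
              have : (m : ℝ) = 2 * i + π := by rw [h]; push_cast; ring
              have hk' : (2 * k : ℝ) + π ≤ n := by exact_mod_cast hk
              linarith
          _ ≤ 2 * K * ((n : ℝ) + 1) * z ^ (-(m : ℝ)) := by
              have : 0 ≤ z ^ (-(m : ℝ)) := Real.rpow_nonneg hz0.le _
              have : 2 * K * z ^ (-(m : ℝ)) * 1 ≤ 2 * K * z ^ (-(m : ℝ)) * ((n : ℝ) + 1) :=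
                mul_le_mul_of_nonneg_left (by linarith) (by positivity)
              linarith
      · rw [abs_zero]; positivity
    calc ∑ i ∈ range (k + 1), |(if m = 2 * i + π then a i z else 0)|
        ≤ ∑ i ∈ range (k + 1), 2 * K * ((n : ℝ) + 1) * z ^ (-(m : ℝ)) := Finset.sum_le_sum hterm
      _ = L * z ^ (-(m : ℝ)) := by rw [Finset.sum_const, Finset.card_range, nsmul_eq_mul, hL]; push_cast; ring
  have hα'b : ∀ m, m < N → ∀ z : ℝ, 1 ≤ z → |deriv (α m) z| ≤ L * z ^ (-(m : ℝ) - 1) := by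
    intro m hm z hz
    have hz0 : 0 < z := by linarith
    rw [(hαder m z (by linarith)).deriv]
    refine (Finset.abs_sum_le_sum_abs _ _).trans ?_
    have hterm : ∀ i ∈ range (k + 1), |(if m = 2 * i + π then a' i z else 0)|
        ≤ 2 * K * ((n : ℝ) + 1) * z ^ (-(m : ℝ) - 1) := by
      intro i hi
      have hi' : i ≤ k := by simp only [Finset.mem_range] at hi; omega
      split_ifs with h
      · calc |a' i z| ≤ K * ((n : ℝ) + 1) * z ^ ((2 * k : ℝ) - n - 2 * i - 1) := (hai i hi' z hz).2
          _ ≤ K * ((n : ℝ) + 1) * z ^ (-(m : ℝ) - 1) := by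
              refine mul_le_mul_of_nonneg_left (Real.rpow_le_rpow_of_exponent_le hz ?_) (by positivity)
              have : (m : ℝ) = 2 * i + π := by rw [h]; push_cast; ring
              have hk' : (2 * k : ℝ) + π ≤ n := by exact_mod_cast hk
              linarith
          _ ≤ 2 * K * ((n : ℝ) + 1) * z ^ (-(m : ℝ) - 1) := by
              have : 0 ≤ K * ((n : ℝ) + 1) * z ^ (-(m : ℝ) - 1) := by positivity
              linarith
      · rw [abs_zero]; positivity
    calc ∑ i ∈ range (k + 1), |(if m = 2 * i + π then a' i z else 0)|
        ≤ ∑ i ∈ range (k + 1), 2 * K * ((n : ℝ) + 1) * z ^ (-(m : ℝ) - 1) := Finset.sum_le_sum hterm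
      _ = L * z ^ (-(m : ℝ) - 1) := by
          rw [Finset.sum_const, Finset.card_range, nsmul_eq_mul, hL]; push_cast; ring
  -- the potential on `[1,∞)`
  set W₀ : ℝ := (n : ℝ) * ((n : ℝ) + 1) + ε with hW₀
  have hW₀0 : 0 ≤ W₀ := by positivity
  have hWb : ∀ z : ℝ, 1 ≤ z → W z ≤ W₀ * z ^ (-(2 : ℝ)) := by
    intro z hz
    have hz0 : 0 < z := by linarith
    have hc := (abs_le.1 (hclose z (by linarith))).2
    have h1 : z ^ (-(5 : ℝ) / 2) ≤ z ^ (-(2 : ℝ)) :=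
      Real.rpow_le_rpow_of_exponent_le hz (by norm_num)
    have h2 : z ^ (-(2 : ℝ)) = (z ^ 2)⁻¹ := by
      rw [Real.rpow_neg hz0.le, Real.rpow_two]
    rw [h2] at h1 ⊢
    rw [hW₀, div_eq_mul_inv] at *
    nlinarith [inv_pos.2 (pow_pos hz0 2)]
  have hbound := tpoly_energy_pointwise (W := W) (p := p) (a := α) (N := N) le_rfl hL0 hW₀0 hp hpt hpz
    hαb hα'b hWb
  obtain ⟨hint, -, hT, hB⟩ := wave1D_farEnergy_tendsto_zero_base hW hW0 hpC (ρ := 1) le_rfl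
    (C := (N : ℝ) ^ 2 * L ^ 2 * ((N : ℝ) ^ 2 + 1 + W₀))
    (fun t z hz => hbound t z (by linarith [abs_nonneg t]) (by linarith [abs_nonneg t]))
  have hint0 := hint 0
  rw [abs_zero, add_zero] at hint0
  refine ⟨p, a 0, a' 0, hpC, fun t x hx => ?_, hint0, hT, hB, ⟨N, α, fun z hz => hp z.1 z.2
    (by linarith [abs_nonneg z.1])⟩, fun x hx => ⟨?_, ?_, ?_⟩, fun x hx => (hder 0 (Nat.zero_le _) x hx).1,
    hcont 0 (Nat.zero_le _), fun x hx => ?_⟩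
  · have h := hpres t x hx
    rwa [hPW x (by linarith)] at h
  · rw [hpform 0 x (by linarith)]
    exact (parity_data_sums (fun i => a i x) k π hπ).1
  · rw [(hpder 0 x hx).1]
    exact (parity_data_sums (fun i => a i x) k π hπ).2
  · rw [(hpder 0 x hx).2]
    exact (parity_data_sums (fun i => a' i x) k π hπ).1
  · have h := hcl 0 (Nat.zero_le _) x hx
    rw [hc0] at h
    simpa using h

end Literature.Analysis.PDE
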